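import Summits.NavierStokesRegularity.FluidComputer.ChiralScrewGroupAction
import Summits.NavierStokesRegularity.FluidComputer.KidaPelzSelectionRules

/-!
# The enantiomorph `P4₁2₁2(y)`: the mirror image of a `P4₃2₁2(y)`-invariant field — `E`, `Z` equal, `H ↦ −H`, and the
# swapped sign pattern on the screw axis

HONEST FRAMING (cell `pub-fluidc`, verbatim): *low prior, high value-of-information experiment on Tao's machine
paradigm; NOT a claim that NS blows up.* Finite Galerkin bookkeeping; nothing concerns the Navier–Stokes PDE.

Paper §G.6, control (b): "the ENANTIOMORPH — `P4₁2₁2` with the mirrored generator is the exact mirror image (`u_B(x) =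
M u_A(Mx)`, `E` and `Z` equal, `H → −H`; `m_y · P4₃2₁2(y) · m_y = P4₁2₁2(y)`): any scorer number that differs between the
two is a bug, not physics." With `m_y = reflY` (`(x, y, z) ↦ (x, −y, z)`, Literature `LatticeSymmetry`) this file types:

* (`reflY_act_coeff_eq` is REUSED from `KidaPelzSelectionRules` — the landed, importable declaration; gate dedup.landed p221308)
* `realAct`, **`act_translate`**: a point operation moves a translation, `g·(τ_a Y) = τ_{g a}(g·Y)` (so `g ∘ (h, b) = (gh,
  g b)` on space-group elements) — the Fourier-side composition law behind `(P₁,t₁)(P₂,t₂) = (P₁P₂, t₁ + P₁t₂)`.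
* `transA' = (π, π/2, π)`, **`screw41 = isoA.sg transA'`** — the `4₁` screw `A' = (P_A, 2π(½, ¼, ½))` of No. 92 (same
  rotation, advance `+¼ L`); its persistence along Galerkin solutions (`screw41_persists_box`).
* **`reflY_screw43`: `m_y · (A·X) = A' · (m_y · X)`** and `reflY_dyad101`: `m_y · (B·X) = B · (m_y · X)` — the Fourier-space
  form of `m_y A m_y = A'`, `m_y B m_y = B` (`ChiralScrewGroup.enantiomorph_pair`); hence **the mirror image of a field fixed
  by `screw43` and `dyad101` is fixed by `screw41` and `dyad101`** (`mirror_invariant`), i.e. by all of `P4₁2₁2(y)`.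
* **`E_S`, `Z_S` EQUAL, `H_S` OPPOSITE** for the mirror pair on a `reflY`-symmetric mode set (`modalHelicity_reflY_act`,
  `truncHelicity_reflY_act`, `mirror_EZH`) — the typed content of `screw.enantiomorph`'s `0.024423 ↔ −0.024423`.
* The `4₁` SELECTION RULES on the screw axis follow from the `4₃` ones through the mirror, with the signs SWAPPED:
  `û(0, 2m, 0) = 0` (`m ≠ 0`) again, but `H(0,4m+1,0) = −2(4m+1)E` and `H(0,4m+3,0) = +2(4m+3)E` (`axis_even'`,
  `axis_helicity_one_mod_four'`, `axis_helicity_three_mod_four'`).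

0 sorry, 0 named facts (D-0026). [folklore]
-/

noncomputable section

namespace Summit.NavierStokesRegularity.FluidComputer.ChiralScrewGroupEnantiomorph

open Literature.Analysis.FluidPDE.FluidComputer
open Literature.Analysis.FluidPDE.FluidComputer.ShellTransfer
open ChiralScrewGroupAction
open Complex ComplexConjugate

/-! ## A point operation moves a translation -/

/-- The point operation on real vectors, `(g a)ᵢ = Σⱼ Mᵢⱼ aⱼ`. [folklore] -/
def realAct (g : LatticeIsometry) (a : Fin 3 → ℝ) : Fin 3 → ℝ := fun i => ∑ j, (g.M i j : ℝ) * a j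

/-- `(Mᵀk)·a = k·(M a)`. [folklore] -/
theorem rdot_invK (g : LatticeIsometry) (k : Fin 3 → ℤ) (a : Fin 3 → ℝ) : rdot (g.invK k) a = rdot k (realAct g a) := by
  unfold rdot realAct LatticeIsometry.invK
  simp only [Int.cast_sum, Int.cast_mul, Finset.sum_mul, Finset.mul_sum]
  rw [Finset.sum_comm]
  exact Finset.sum_congr rfl fun i _ => Finset.sum_congr rfl fun j _ => by ring

/-- `e^{−i(Mᵀk)·a} = e^{−ik·(Ma)}`. [folklore] -/
theorem phase_invK (g : LatticeIsometry) (k : Fin 3 → ℤ) (a : Fin 3 → ℝ) : phase a (g.invK k) = phase (realAct g a) k := by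
  unfold phase
  rw [rdot_invK]

/-- **`g · (τ_a Y) = τ_{g a} (g · Y)`**: conjugating a translation by a point operation rotates the translation vector.
[folklore] -/
theorem act_translate (g : LatticeIsometry) (a : Fin 3 → ℝ) (Y : FourierVelocity) :
    g.act (translate a Y) = translate (realAct g a) (g.act Y) := by
  refine TaylorGreenHat.fourierVelocity_ext ?_
  funext k i
  rw [LatticeIsometry.act_coeff, translate_coeff, LatticeIsometry.act_coeff, Finset.mul_sum]
  refine Finset.sum_congr rfl fun j _ => ?_
  rw [translate_coeff, phase_invK]
  ring

/-! ## The `4₁` screw and the mirror `m_y` -/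

/-- The screw translation `a' = 2π (½, ¼, ½) = (π, π/2, π)` of the `4₁` element `A'`. [folklore] -/
def transA' : Fin 3 → ℝ := ![Real.pi, Real.pi / 2, Real.pi]

/-- **The `4₁` screw `A'` acting on Fourier velocity fields** (rotation `P_A`, advance `+¼ L`). [folklore] -/
def screw41 (X : FourierVelocity) : FourierVelocity := isoA.sg transA' X

/-- Persistence of the `4₁` symmetry on the engines' cubic mask, no side condition. [folklore] -/
theorem screw41_persists_box {K : ℕ} {U : ℝ → FourierVelocity} {ν : ℝ} {c : ℝ → (Fin 3 → ℤ) → ℂ}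
    (hU : IsGalerkinSolution U (Dealiasing.box K) ν c fun _ _ _ => 0) (hs : IsSupportedOn U (Dealiasing.box K))
    {t₀ : ℝ} (h0 : screw41 (U t₀) = U t₀) (t : ℝ) : screw41 (U t) = U t :=
  isoA.sg_eq_self hU hs (fun _ hp => isoA.invK_mem_box hp) (fun _ hp => isoA.actK_mem_box hp) transA' h0 t

/-- `m_y a = (π, −3π/2, π)`. [folklore] -/
theorem realAct_reflY_transA : realAct reflY transA = ![Real.pi, -(3 * Real.pi / 2), Real.pi] := by
  funext i
  unfold realAct reflY transA
  fin_cases i <;> simp [Fin.sum_univ_three]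

/-- `τ_{(π, −3π/2, π)} = τ_{(π, π/2, π)}`: the phases differ by `e^{2πik₁} = 1`. [folklore] -/
theorem phase_reflY_transA (k : Fin 3 → ℤ) : phase ![Real.pi, -(3 * Real.pi / 2), Real.pi] k = phase transA' k := by
  unfold phase rdot transA'
  simp only [Fin.sum_univ_three, Matrix.cons_val_zero, Matrix.cons_val_one, Matrix.head_cons, Matrix.cons_val_two,
    Matrix.tail_cons]
  have e : (((-((k 0 : ℝ) * Real.pi + (k 1 : ℝ) * -(3 * Real.pi / 2) + (k 2 : ℝ) * Real.pi) : ℝ)) : ℂ) * I =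
      ((-((k 0 : ℝ) * Real.pi + (k 1 : ℝ) * (Real.pi / 2) + (k 2 : ℝ) * Real.pi) : ℝ) : ℂ) * I +
        ((k 1 : ℤ) : ℂ) * (2 * Real.pi * I) := by
    push_cast; ring
  rw [e, Complex.exp_add, Complex.exp_int_mul_two_pi_mul_I, mul_one]

/-- `P_Aᵀ` and `m_y` commute on wavevectors. [folklore] -/
theorem invK_comm_A (k : Fin 3 → ℤ) : isoA.invK (reflY.invK k) = reflY.invK (isoA.invK k) := by
  rw [reflY_invK, reflY_invK, isoA_invK, isoA_invK]
  funext i; fin_cases i <;> simp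

/-- `P_Bᵀ` and `m_y` commute on wavevectors. [folklore] -/
theorem invK_comm_B (k : Fin 3 → ℤ) : isoB.invK (reflY.invK k) = reflY.invK (isoB.invK k) := by
  rw [reflY_invK, reflY_invK, isoB_invK, isoB_invK]
  funext i; fin_cases i <;> simp

/-- `m_y P_A = P_A m_y` on fields. [folklore] -/
theorem reflY_act_isoA_act (Y : FourierVelocity) : reflY.act (isoA.act Y) = isoA.act (reflY.act Y) := by
  refine TaylorGreenHat.fourierVelocity_ext ?_
  funext k i
  simp only [LatticeIsometry.act_coeff]
  rw [invK_comm_A]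
  unfold reflY isoA
  fin_cases i <;> simp [Fin.sum_univ_three]

/-- `m_y P_B = P_B m_y` on fields: **`m_y · (B·X) = B · (m_y · X)`**. [folklore] -/
theorem reflY_dyad101 (Y : FourierVelocity) : reflY.act (dyad101 Y) = dyad101 (reflY.act Y) := by
  refine TaylorGreenHat.fourierVelocity_ext ?_
  funext k i
  show (reflY.act (isoB.act Y)).coeff k i = (isoB.act (reflY.act Y)).coeff k i
  simp only [LatticeIsometry.act_coeff]
  rw [invK_comm_B]
  unfold reflY isoB
  fin_cases i <;> simp [Fin.sum_univ_three]

/-- **`m_y · (A·X) = A' · (m_y · X)`** — the Fourier-space form of `m_y A m_y = A'`: the mirror turns the `4₃` screw into the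
`4₁` screw. [folklore] -/
theorem reflY_screw43 (X : FourierVelocity) : reflY.act (screw43 X) = screw41 (reflY.act X) := by
  show reflY.act (translate transA (isoA.act X)) = translate transA' (isoA.act (reflY.act X))
  rw [act_translate, realAct_reflY_transA, reflY_act_isoA_act]
  refine TaylorGreenHat.fourierVelocity_ext ?_
  funext k i
  rw [translate_coeff, translate_coeff, phase_reflY_transA]

/-- `m_y` is an involution on fields. [folklore] -/
theorem reflY_act_reflY_act (X : FourierVelocity) : reflY.act (reflY.act X) = X := by
  refine TaylorGreenHat.fourierVelocity_ext ?_
  funext k i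
  simp only [LatticeIsometry.act_coeff]
  have hk : reflY.invK (reflY.invK k) = k := by
    rw [reflY_invK, reflY_invK]; funext j; fin_cases j <;> simp
  rw [hk]
  unfold reflY
  fin_cases i <;> simp [Fin.sum_univ_three]

/-- … so also `m_y · (A'·Y) = A · (m_y · Y)`. [folklore] -/
theorem reflY_screw41 (Y : FourierVelocity) : reflY.act (screw41 Y) = screw43 (reflY.act Y) := by
  have h := reflY_screw43 (reflY.act Y)
  rw [reflY_act_reflY_act] at h
  rw [← h, reflY_act_reflY_act]

/-- **THE MIRROR IMAGE OF A `P4₃2₁2(y)`-INVARIANT FIELD IS `P4₁2₁2(y)`-INVARIANT**: fixed by `screw43` and `dyad101` ⇒ the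
`reflY`-image is fixed by `screw41` and `dyad101` (the generators of No. 92), and conversely. [folklore] -/
theorem mirror_invariant {X : FourierVelocity} (hA : screw43 X = X) (hB : dyad101 X = X) :
    screw41 (reflY.act X) = reflY.act X ∧ dyad101 (reflY.act X) = reflY.act X := by
  constructor
  · rw [← reflY_screw43, hA]
  · rw [← reflY_dyad101, hB]

/-! ## `E`, `Z` equal, `H ↦ −H` -/

/-- **Helicity is odd under the mirror `y ↦ −y`**: `H[reflY·û](k) = −H[û](Mᵀk)`. [folklore] -/
theorem modalHelicity_reflY_act (A : FourierVelocity) (k : Fin 3 → ℤ) :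
    modalHelicity (reflY.act A) k = -modalHelicity A (reflY.invK k) := by
  unfold modalHelicity
  rw [← Complex.neg_re]
  congr 1
  have hb : ∀ j, (reflY.act A).coeff k j =
      (![A.coeff (reflY.invK k) 0, -(A.coeff (reflY.invK k) 1), A.coeff (reflY.invK k) 2] : Fin 3 → ℂ) j :=
    fun j => congrFun (KidaPelzSelectionRules.reflY_act_coeff_eq A k) j
  have hk : ∀ i, reflY.invK k i = (![k 0, -k 1, k 2] : Fin 3 → ℤ) i := fun i => congrFun (reflY_invK k) i
  simp only [Fin.sum_univ_three, curl_coeff, kcross_zero, kcross_one, kcross_two, hb, hk, map_mul, Complex.conj_I,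
    map_sub, map_intCast, map_neg, Matrix.cons_val_zero, Matrix.cons_val_one, Matrix.head_cons, Matrix.cons_val_two,
    Matrix.tail_cons, Int.cast_neg]
  ring

/-- Hence `H_S[reflY·û] = −H_S[û]` on a `reflY`-symmetric mode set. [folklore] -/
theorem truncHelicity_reflY_act (A : FourierVelocity) {S : Finset (Fin 3 → ℤ)}
    (hS : ∀ p ∈ S, reflY.invK p ∈ S) : truncHelicity (reflY.act A) S = -truncHelicity A S := by
  unfold truncHelicity
  rw [Finset.sum_congr rfl fun k _ => modalHelicity_reflY_act A k, Finset.sum_neg_distrib,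
    reflY.sum_comp_invK hS (fun q => modalHelicity A q)]

/-- **`E_S`, `Z_S` EQUAL and `H_S ↦ −H_S` for the mirror pair** on a `reflY`-symmetric mode set (the typed content of
`screw.enantiomorph`'s `E, Z` equal, `H: 0.024423 ↔ −0.024423`); `E`, `Z` by the Literature's `truncEnergy_act` /
`truncEnstrophy_act`. [folklore] -/
theorem mirror_EZH (X : FourierVelocity) {S : Finset (Fin 3 → ℤ)} (hS : ∀ p ∈ S, reflY.invK p ∈ S) :
    truncEnergy (reflY.act X) S = truncEnergy X S ∧ truncEnstrophy (reflY.act X) S = truncEnstrophy X S ∧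
      truncHelicity (reflY.act X) S = -truncHelicity X S :=
  ⟨reflY.truncEnergy_act X hS, reflY.truncEnstrophy_act X hS, truncHelicity_reflY_act X hS⟩

/-! ## The `4₁` selection rules on the screw axis: same emptiness, swapped signs -/

/-- `E(−k) = E(k)` (reality). [folklore] -/
theorem modalEnergy_neg (A : FourierVelocity) (k : Fin 3 → ℤ) : modalEnergy A (-k) = modalEnergy A k := by
  unfold modalEnergy
  congr 1
  exact Finset.sum_congr rfl fun j _ => by rw [A.reality, Complex.normSq_conj]

/-- The mirror maps the axis mode `(0, k₁, 0)` to `(0, −k₁, 0) = −(0, k₁, 0)`. [folklore] -/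
theorem reflY_invK_axis (k₁ : ℤ) : reflY.invK ![0, k₁, 0] = -![0, k₁, 0] := by
  rw [reflY_invK]
  funext i; fin_cases i <;> simp

/-- **`4₁`: even axis modes are empty too** — `screw41 Y = Y ⇒ û(0, 2m, 0) = 0`, `m ≠ 0`. [folklore] -/
theorem axis_even' {Y : FourierVelocity} (h : screw41 Y = Y) (m : ℤ) (hm : m ≠ 0) : Y.coeff ![0, 2 * m, 0] = 0 := by
  have hX : screw43 (reflY.act Y) = reflY.act Y := by rw [← reflY_screw41, h]
  have hz := axis_even hX (-m) (neg_ne_zero.mpr hm)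
  have e := KidaPelzSelectionRules.reflY_act_coeff_eq Y ![0, 2 * -m, 0]
  rw [hz, reflY_invK_axis] at e
  have hk : (-![0, 2 * -m, 0] : Fin 3 → ℤ) = ![0, 2 * m, 0] := by funext i; fin_cases i <;> simp
  rw [hk] at e
  have e0 := congrFun e 0
  have e1 := congrFun e 1
  have e2 := congrFun e 2
  simp only [Pi.zero_apply, Matrix.cons_val_zero, Matrix.cons_val_one, Matrix.head_cons, Matrix.cons_val_two,
    Matrix.tail_cons] at e0 e1 e2
  funext i
  fin_cases i
  · exact e0.symm
  · exact (neg_eq_zero.mp e1.symm)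
  · exact e2.symm

/-- `H[Y](0, k₁, 0) = −H[m_y·Y](0, k₁, 0)` and `E[Y](0, k₁, 0) = E[m_y·Y](0, k₁, 0)`. [folklore] -/
theorem axis_mirror (Y : FourierVelocity) (k₁ : ℤ) :
    modalHelicity Y ![0, k₁, 0] = -modalHelicity (reflY.act Y) ![0, k₁, 0] ∧
      modalEnergy Y ![0, k₁, 0] = modalEnergy (reflY.act Y) ![0, k₁, 0] := by
  rw [modalHelicity_reflY_act, reflY.modalEnergy_act, reflY_invK_axis, modalHelicity_neg, modalEnergy_neg]
  exact ⟨(neg_neg _).symm, rfl⟩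

/-- **`4₁`, `k₁ ≡ 1 (mod 4)`: `H(0,k₁,0) = −2k₁E`** (the `4₃` sign, swapped). [folklore] -/
theorem axis_helicity_one_mod_four' {Y : FourierVelocity} (h : screw41 Y = Y) (m : ℤ) :
    modalHelicity Y ![0, 4 * m + 1, 0] = -(2 * ((4 * m + 1 : ℤ) : ℝ)) * modalEnergy Y ![0, 4 * m + 1, 0] := by
  have hX : screw43 (reflY.act Y) = reflY.act Y := by rw [← reflY_screw41, h]
  obtain ⟨hH, hE⟩ := axis_mirror Y (4 * m + 1)
  rw [hH, hE, axis_helicity_one_mod_four hX m]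
  ring

/-- **`4₁`, `k₁ ≡ 3 (mod 4)`: `H(0,k₁,0) = +2k₁E`.** [folklore] -/
theorem axis_helicity_three_mod_four' {Y : FourierVelocity} (h : screw41 Y = Y) (m : ℤ) :
    modalHelicity Y ![0, 4 * m + 3, 0] = 2 * ((4 * m + 3 : ℤ) : ℝ) * modalEnergy Y ![0, 4 * m + 3, 0] := by
  have hX : screw43 (reflY.act Y) = reflY.act Y := by rw [← reflY_screw41, h]
  obtain ⟨hH, hE⟩ := axis_mirror Y (4 * m + 3)
  rw [hH, hE, axis_helicity_three_mod_four hX m]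
  ring

end Summit.NavierStokesRegularity.FluidComputer.ChiralScrewGroupEnantiomorph
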